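import Summits.BirchSwinnertonDyer.BirchSwinnertonDyer.Theorems.ByReductionTypeAtTwoRankOneAtTwoOffBigImageOddLocalEngineImageTokens
import HarnessLib

/-!
# Route `ByReductionTypeAtTwo`, crux `RankOneAtTwoOffBigImageOddLocal` (stmt-BirchSwinnertonDyer-23716), line
# `refined_kolyvagin_tamagawa_shift_at_two` — ENGINE PORT `c₀ ↦ h₀` (regular element), §K THE ENGINE PORT END-TO-END: skeleton binders ⟹ a regular Kolyvagin prime with exact local orders

Lead prover `prover-cruxlead-stmt-BirchSwinnertonDyer-23716-g0` (2026-08-28), landing the crux-plan g6 ENGINE QUARRY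
`Cruxes/RankOneAtTwoOffBigImageOddLocal/RefinedKolyvaginEngineG6.lean` (planner `cruxplan-…-23716-refined-kolyvag-9ff2fe475f-g6`, v10, ≈2800 lines,
rc 0 / 0 sorry; `Cruxes/` files are not importable, so the lead COPIES the proofs into `Theorems/` — card «LEAD QUICKSTART (g6)» Q2 #3 / Q4) as
`--supports stmt-BirchSwinnertonDyer-23716` helpers, continuing `…Engine{Dictionary,Parity,Cyclotomic,CyclotomicBasis,GoursatLift,Chebotarev,RegularSupply,
RegularLift}.lean`.  The engine port = kernel-closable item #3 of the pen's order (PEN-PICK-23716 ADD-4): Kolyvagin primes whose Frobenius is a REGULAR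
element `h₀` (det `−1`, trace `0`, odd mod `2`; LOSSLESS local Kummer maps by R1/LKL) instead of complex conjugation `c₀` (which loses the top bit at
`Δ > 0`, residual 24883), with McCallum's exact local orders — the supply the line's filtered stubs `…WithOn Φ_reg Ω` consume (card #7
`regular-frobenius-kolyvagin-primes-pos-disc`).  THIS FILE: §K — `exists_regular_kolyvaginPrime_of_supply`, `exists_regular_kolyvaginPrime_of_doorAdmissible`, `exists_regular_kolyvaginPrime_of_heegner`: §J (regular element) → §H (Step B) → §F (Steps C–H): from the line's stub binders (non-CM irrelevant; `ρ̄_{E,2^{M+1}}` onto resp. the door/Heegner field data) for every bound a Kolyvagin prime `ℓ` for `p = 2` whose Frobenius acts on `E[2^M]` as a REGULAR involution (lossless) with `2^M ∣ ℓ + 1`, `2^M ∣ a_ℓ` and McCallum's exact local orders `ord c_{i,λ} = 2^{N_i}` — modulo only the tree's named Čebotarev fact `Automorphic.chebotarev_artinRep` (hypothesis).  This is the pen's kernel-closable #3 delivered end-to-end.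

Statements and proofs are the quarry's VERBATIM (namespace moved to `…Theorems.OffBigImageOddLocalAtTwo.Engine`).  Nothing here proves the crux,
`BSDp W 2`, BSD or the summit; no registered stub is discharged (engine inputs only).  BSD is not proved.

Refs: [GrossLMS1991] §3 (3.1)–(3.3), §9; [McCallumLMS1991] §3 (Cor. 3.2, Prop. 3.1), §5; [SilvermanAEC2009] III.7–III.8, VII–VIII; Serre (1972) §5.3.
-/

set_option linter.dupNamespace false -- tree convention: `Summit.BirchSwinnertonDyer.BirchSwinnertonDyer.Theorems` (summit = sub-problem)
set_option autoImplicit false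

noncomputable section

namespace Summit.BirchSwinnertonDyer.BirchSwinnertonDyer.Theorems.OffBigImageOddLocalAtTwo.Engine

/-! ## §K  THE ENGINE PORT END-TO-END (pen kernel-closable #3, PROVED modulo nothing new): skeleton binders ⟹ a regular
Kolyvagin prime with exact local orders — §J (regular element) → §H (Step B) → §F (Steps C–H). -/

section EnginePortK

open scoped Classical Pointwise
open WeierstrassCurve NumberField IsDedekindDomain Field
open Literature.NumberTheory.GaloisRepresentations Literature.NumberTheory.EllipticCurves
open Literature.NumberTheory
open Rat.HeightOneSpectrum
open Summit.BirchSwinnertonDyer.BirchSwinnertonDyer.Theorems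

universe u

variable {W : WeierstrassCurve ℚ} {K : Type u} [Field K] [NumberField K]

/-- **THE REGULAR KOLYVAGIN PRIME FROM THE SKELETON'S BINDERS (E-port = §J → §H → §F, PROVED).**  `E/ℚ` globally minimal, `K` imaginary
quadratic with `d_K` door-admissible, `ρ̄_{E,2^{M}}` surjective (`M = n+1 ≥ 1`), `c₀` complex conjugation, `c ≠ 1` in `Gal(K/ℚ)`, the tree's image
tokens `hS`/`hC` on `E(K̄)[2]`, and τ-stable Selmer-class data `cs, π, e, Nv` exactly as in the tree's Step B: then there are `ρ ∈ Γ_K` with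
`h := c₀ · res ρ` an INVOLUTION on `E(ℚ̄)[2^M]` acting there as the REGULAR involution `[[1,1],[0,-1]]` (so `Frob_ℓ ∼ h` has `tr ≡ 0`,
`det ≡ -1`, and `Ẽ(𝔽_ℓ)[2^∞]` CYCLIC — not `∼ c₀`), and for every bound `b` a Kolyvagin prime `ℓ > b`: `ℓ ∤ 2 N d_K`, `(ℓ)` inert in `K`,
a Frobenius above `ℓ` acting on `E[2^M]` as `h` and on `K` as `c₀`, `2^M ∣ ℓ + 1`, `2^M ∣ a_ℓ`, and `ord c_{i,λ} = 2^{Nv i}` exactly at `λ ∋ ℓ`.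
Conditional only on the displayed tree theorem-token `hC : Automorphic.chebotarev_artinRep`.  This is the pen's kernel-closable #3 up to
the renaming of the `FrobEqFrobInfty` token in the Euler-system files (E4). [cite: GrossLMS1991, §3 (3.1)–(3.3), §9 Prop. 9.3]
[cite: McCallumLMS1991, §3 Cor. 3.2] -/
theorem exists_regular_kolyvaginPrime_of_supply (hCheb : Automorphic.chebotarev_artinRep) {N : ℕ}
    [NeZero N] [W.IsElliptic] [W.IsGloballyMinimal] (hK : IsImaginaryQuadratic K) (n : ℕ)
    {c₀ : absoluteGaloisGroup ℚ} (hc₀ : IsComplexConjugation (Rat.castHom ℝ) c₀)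
    (hsup : ∀ A : AddAut (geomTorsion W ((2 ^ (n + 1) : ℕ) : ℤ)),
      ∃ ρ₀ : absoluteGaloisGroup K, ∀ P : geomTorsion W ((2 ^ (n + 1) : ℕ) : ℤ),
        (c₀ * absGaloisRestrict ℚ K ρ₀) • P = A P)
    {c : K ≃ₐ[ℚ] K} (hc : c ≠ 1)
    (hS : ∀ H : AddSubgroup (geomTorsion (W.baseChange K) 2),
      (∀ g : absoluteGaloisGroup K, ∀ t ∈ H, g • t ∈ H) → H = ⊥ ∨ H = ⊤)
    (hC : ∀ f : geomTorsion (W.baseChange K) 2 →+ geomTorsion (W.baseChange K) 2,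
      (∀ (g : absoluteGaloisGroup K) (t : geomTorsion (W.baseChange K) 2), f (g • t) = g • f t) →
        ∃ c : ℤ, ∀ t, f t = c • t)
    {r : ℕ} (cs : Fin r → galH1Torsion (W.baseChange K) ((2 ^ (n + 1) : ℕ) : ℤ)) {π : Fin r → Fin r}
    (hπ : ∀ i, π (π i) = i) (hcs : ∀ i, conjAct W c ((2 ^ (n + 1) : ℕ) : ℤ) (cs i) = cs (π i))
    (e : Fin r → ℕ) (he : ∀ i, ((2 : ℤ) ^ e i) • cs i = 0)
    (hind : ∀ a : Fin r → ℤ, ∑ i, a i • cs i = 0 → ∀ i, ((2 : ℤ) ^ e i) ∣ a i)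
    (hres : ∀ a : Fin r → ℤ, (∀ ρ ∈ torsionFixing (W.baseChange K) ((2 ^ (n + 1) : ℕ) : ℤ),
      h1Eval (W.baseChange K) ((2 ^ (n + 1) : ℕ) : ℤ) (∑ i, a i • cs i) ρ = 0) → ∑ i, a i • cs i = 0)
    (Nv : Fin r → ℕ) (hNe : ∀ i, Nv i ≤ e i) (heM : ∀ i, e i ≤ n + 1) (hNπ : ∀ i, Nv (π i) = Nv i)
    (b : ℕ) :
    ∃ ρ : absoluteGaloisGroup K,
      (∀ X : geomTorsion W ((2 ^ (n + 1) : ℕ) : ℤ),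
        (c₀ * absGaloisRestrict ℚ K ρ) • (c₀ * absGaloisRestrict ℚ K ρ) • X = X) ∧
      (∀ ζ : AlgebraicClosure ℚ, ζ ^ (2 ^ (n + 1)) = 1 → (c₀ * absGaloisRestrict ℚ K ρ) • ζ = ζ⁻¹) ∧
      (∃ P : geomTorsion W ((2 ^ (n + 1) : ℕ) : ℤ),
        (2 : ℤ) ^ n • (P + (c₀ * absGaloisRestrict ℚ K ρ) • P) ≠ 0) ∧
      (∀ (k : ℕ) (X : geomTorsion W ((2 ^ (n + 1) : ℕ) : ℤ)), (2 : ℤ) ^ k • X = 0 →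
          (c₀ * absGaloisRestrict ℚ K ρ) • X = X →
          ∃ Y : geomTorsion W ((2 ^ (n + 1) : ℕ) : ℤ),
            (2 : ℤ) ^ k • Y = 0 ∧ X = Y + (c₀ * absGaloisRestrict ℚ K ρ) • Y) ∧
      ∃ ℓ : ℕ, b < ℓ ∧ ℓ.Prime ∧ ¬ ℓ ∣ N ∧ ¬ ((ℓ : ℤ) ∣ NumberField.discr K) ∧ ℓ ≠ 2 ∧
        (Ideal.span {(ℓ : 𝓞 K)}).IsPrime ∧
        (∃ (v : HeightOneSpectrum (𝓞 ℚ)) (𝔓 : Ideal (absIntegers (𝓞 ℚ) ℚ)) (h : absoluteGaloisGroup ℚ),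
          (ℓ : 𝓞 ℚ) ∈ v.asIdeal ∧ 𝔓 ∈ v.primesAbove ∧ IsArithFrobAt (𝓞 ℚ) h 𝔓 ∧
          (∀ P : geomTorsion W ((2 ^ (n + 1) : ℕ) : ℤ), h • P = (c₀ * absGaloisRestrict ℚ K ρ) • P) ∧
          ∀ (e : K →ₐ[ℚ] AlgebraicClosure ℚ) (x : K), h • e x = c₀ • e x) ∧
        2 ^ (n + 1) ∣ ℓ + 1 ∧ ((2 : ℤ) ^ (n + 1)) ∣ W.frobeniusTrace ℓ ∧
        ∀ i, ∀ v : HeightOneSpectrum (𝓞 K), (ℓ : 𝓞 K) ∈ v.asIdeal →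
          (((2 : ℤ) ^ Nv i) • cs i ∈
              (W.baseChange K).torsionLocalKer (v.adicCompletion K) ((2 ^ (n + 1) : ℕ) : ℤ) ∧
            (Nv i ≠ 0 → ((2 : ℤ) ^ (Nv i - 1)) • cs i ∉
              (W.baseChange K).torsionLocalKer (v.adicCompletion K) ((2 ^ (n + 1) : ℕ) : ℤ))) := by
  obtain ⟨ρ₀, P, hsq, hP1, hker, hμ'⟩ := exists_regular_galoisElement_of_supply (K := K) n c₀ hsup
  have hM : 1 ≤ n + 1 := by omega
  obtain ⟨ρ, hact, hsqρ, hρ⟩ := exists_galoisElement_regular_rat (W := W) hK hM hc₀ hc hS hC ρ₀ hsq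
    (P := P) (fun _ ↦ by simpa using hP1) (fun k X _ h1 h2 ↦ hker k X h1 h2) hπ hcs e he hind hres
    Nv hNe heM hNπ
  have hμ : ∀ ζ : AlgebraicClosure ℚ, ζ ^ (2 ^ (n + 1)) = 1 →
      (c₀ * absGaloisRestrict ℚ K ρ) • ζ = ζ⁻¹ := hμ' _ hact
  refine ⟨ρ, hsqρ, hμ, ⟨P, ?_⟩, fun k X h1 h2 ↦ ?_,
    exists_kolyvaginPrime_gt_two_of_galoisElement_regular hCheb hK hM hc₀ hc cs Nv hsqρ hμ hρ b⟩
  · rw [hact]; exact hP1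
  · rw [hact] at h2
    obtain ⟨Y, hY, hXY⟩ := hker k X h1 h2
    exact ⟨Y, hY, by rw [hact]; exact hXY⟩

/-- **THE REGULAR KOLYVAGIN PRIME FOR THE DOOR-LAW STUBS** (binder `DoorAdmissible W d_K`). [cite: GrossLMS1991, §3, §9] -/
theorem exists_regular_kolyvaginPrime_of_doorAdmissible (hCheb : Automorphic.chebotarev_artinRep) {N : ℕ}
    [NeZero N] [W.IsElliptic] [W.IsGloballyMinimal] (hK : IsImaginaryQuadratic K)
    (hD : RankOneAtTwoOneDoor.DoorAdmissible W (NumberField.discr K)) (n : ℕ)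
    (hρ2 : W.HasSurjectiveModNGaloisRep 2) (hsurj : W.HasSurjectiveModNGaloisRep ((2 ^ (n + 1) : ℕ) : ℤ))
    {c₀ : absoluteGaloisGroup ℚ} (hc₀ : IsComplexConjugation (Rat.castHom ℝ) c₀)
    {c : K ≃ₐ[ℚ] K} (hc : c ≠ 1)
    {r : ℕ} (cs : Fin r → galH1Torsion (W.baseChange K) ((2 ^ (n + 1) : ℕ) : ℤ)) {π : Fin r → Fin r}
    (hπ : ∀ i, π (π i) = i) (hcs : ∀ i, conjAct W c ((2 ^ (n + 1) : ℕ) : ℤ) (cs i) = cs (π i))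
    (e : Fin r → ℕ) (he : ∀ i, ((2 : ℤ) ^ e i) • cs i = 0)
    (hind : ∀ a : Fin r → ℤ, ∑ i, a i • cs i = 0 → ∀ i, ((2 : ℤ) ^ e i) ∣ a i)
    (hres : ∀ a : Fin r → ℤ, (∀ ρ ∈ torsionFixing (W.baseChange K) ((2 ^ (n + 1) : ℕ) : ℤ),
      h1Eval (W.baseChange K) ((2 ^ (n + 1) : ℕ) : ℤ) (∑ i, a i • cs i) ρ = 0) → ∑ i, a i • cs i = 0)
    (Nv : Fin r → ℕ) (hNe : ∀ i, Nv i ≤ e i) (heM : ∀ i, e i ≤ n + 1) (hNπ : ∀ i, Nv (π i) = Nv i)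
    (b : ℕ) :
    ∃ ρ : absoluteGaloisGroup K,
      (∀ X : geomTorsion W ((2 ^ (n + 1) : ℕ) : ℤ),
        (c₀ * absGaloisRestrict ℚ K ρ) • (c₀ * absGaloisRestrict ℚ K ρ) • X = X) ∧
      (∀ ζ : AlgebraicClosure ℚ, ζ ^ (2 ^ (n + 1)) = 1 → (c₀ * absGaloisRestrict ℚ K ρ) • ζ = ζ⁻¹) ∧
      (∃ P : geomTorsion W ((2 ^ (n + 1) : ℕ) : ℤ),
        (2 : ℤ) ^ n • (P + (c₀ * absGaloisRestrict ℚ K ρ) • P) ≠ 0) ∧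
      (∀ (k : ℕ) (X : geomTorsion W ((2 ^ (n + 1) : ℕ) : ℤ)), (2 : ℤ) ^ k • X = 0 →
          (c₀ * absGaloisRestrict ℚ K ρ) • X = X →
          ∃ Y : geomTorsion W ((2 ^ (n + 1) : ℕ) : ℤ),
            (2 : ℤ) ^ k • Y = 0 ∧ X = Y + (c₀ * absGaloisRestrict ℚ K ρ) • Y) ∧
      ∃ ℓ : ℕ, b < ℓ ∧ ℓ.Prime ∧ ¬ ℓ ∣ N ∧ ¬ ((ℓ : ℤ) ∣ NumberField.discr K) ∧ ℓ ≠ 2 ∧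
        (Ideal.span {(ℓ : 𝓞 K)}).IsPrime ∧
        (∃ (v : HeightOneSpectrum (𝓞 ℚ)) (𝔓 : Ideal (absIntegers (𝓞 ℚ) ℚ)) (h : absoluteGaloisGroup ℚ),
          (ℓ : 𝓞 ℚ) ∈ v.asIdeal ∧ 𝔓 ∈ v.primesAbove ∧ IsArithFrobAt (𝓞 ℚ) h 𝔓 ∧
          (∀ P : geomTorsion W ((2 ^ (n + 1) : ℕ) : ℤ), h • P = (c₀ * absGaloisRestrict ℚ K ρ) • P) ∧
          ∀ (e : K →ₐ[ℚ] AlgebraicClosure ℚ) (x : K), h • e x = c₀ • e x) ∧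
        2 ^ (n + 1) ∣ ℓ + 1 ∧ ((2 : ℤ) ^ (n + 1)) ∣ W.frobeniusTrace ℓ ∧
        ∀ i, ∀ v : HeightOneSpectrum (𝓞 K), (ℓ : 𝓞 K) ∈ v.asIdeal →
          (((2 : ℤ) ^ Nv i) • cs i ∈
              (W.baseChange K).torsionLocalKer (v.adicCompletion K) ((2 ^ (n + 1) : ℕ) : ℤ) ∧
            (Nv i ≠ 0 → ((2 : ℤ) ^ (Nv i - 1)) • cs i ∉
              (W.baseChange K).torsionLocalKer (v.adicCompletion K) ((2 ^ (n + 1) : ℕ) : ℤ))) := by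
  obtain ⟨hS, hC⟩ := imageTokens_two_of_doorAdmissible (W := W) hK hD hρ2
  exact exists_regular_kolyvaginPrime_of_supply hCheb hK n hc₀ (fun A ↦
    exists_mul_absGaloisRestrict_smul_eq_addAut_of_doorAdmissible hK hD hsurj c₀ A) hc hS hC cs hπ hcs e he hind hres Nv hNe heM hNπ b

/-- **THE REGULAR KOLYVAGIN PRIME FOR THE BIG-IMAGE STUBS S3/S4/S5** (binders `Odd d_K`, `SatisfiesHeegnerHypothesis N_E K` — verbatim those of
`SigmaAccumulationAtTwo` / `StringentPrimitivityAtTwo` / `ShiftedKolyvaginStructureAtTwo`). [cite: GrossLMS1991, §3, §9] -/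
theorem exists_regular_kolyvaginPrime_of_heegner (hCheb : Automorphic.chebotarev_artinRep) {N : ℕ}
    [NeZero N] [W.IsElliptic] [W.IsGloballyMinimal] (hK : IsImaginaryQuadratic K)
    (hodd : Odd (NumberField.discr K)) (hH : SatisfiesHeegnerHypothesis (W.conductorNorm ℤ) K) (n : ℕ)
    (hρ2 : W.HasSurjectiveModNGaloisRep 2) (hsurj : W.HasSurjectiveModNGaloisRep ((2 ^ (n + 1) : ℕ) : ℤ))
    {c₀ : absoluteGaloisGroup ℚ} (hc₀ : IsComplexConjugation (Rat.castHom ℝ) c₀)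
    {c : K ≃ₐ[ℚ] K} (hc : c ≠ 1)
    {r : ℕ} (cs : Fin r → galH1Torsion (W.baseChange K) ((2 ^ (n + 1) : ℕ) : ℤ)) {π : Fin r → Fin r}
    (hπ : ∀ i, π (π i) = i) (hcs : ∀ i, conjAct W c ((2 ^ (n + 1) : ℕ) : ℤ) (cs i) = cs (π i))
    (e : Fin r → ℕ) (he : ∀ i, ((2 : ℤ) ^ e i) • cs i = 0)
    (hind : ∀ a : Fin r → ℤ, ∑ i, a i • cs i = 0 → ∀ i, ((2 : ℤ) ^ e i) ∣ a i)
    (hres : ∀ a : Fin r → ℤ, (∀ ρ ∈ torsionFixing (W.baseChange K) ((2 ^ (n + 1) : ℕ) : ℤ),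
      h1Eval (W.baseChange K) ((2 ^ (n + 1) : ℕ) : ℤ) (∑ i, a i • cs i) ρ = 0) → ∑ i, a i • cs i = 0)
    (Nv : Fin r → ℕ) (hNe : ∀ i, Nv i ≤ e i) (heM : ∀ i, e i ≤ n + 1) (hNπ : ∀ i, Nv (π i) = Nv i)
    (b : ℕ) :
    ∃ ρ : absoluteGaloisGroup K,
      (∀ X : geomTorsion W ((2 ^ (n + 1) : ℕ) : ℤ),
        (c₀ * absGaloisRestrict ℚ K ρ) • (c₀ * absGaloisRestrict ℚ K ρ) • X = X) ∧
      (∀ ζ : AlgebraicClosure ℚ, ζ ^ (2 ^ (n + 1)) = 1 → (c₀ * absGaloisRestrict ℚ K ρ) • ζ = ζ⁻¹) ∧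
      (∃ P : geomTorsion W ((2 ^ (n + 1) : ℕ) : ℤ),
        (2 : ℤ) ^ n • (P + (c₀ * absGaloisRestrict ℚ K ρ) • P) ≠ 0) ∧
      (∀ (k : ℕ) (X : geomTorsion W ((2 ^ (n + 1) : ℕ) : ℤ)), (2 : ℤ) ^ k • X = 0 →
          (c₀ * absGaloisRestrict ℚ K ρ) • X = X →
          ∃ Y : geomTorsion W ((2 ^ (n + 1) : ℕ) : ℤ),
            (2 : ℤ) ^ k • Y = 0 ∧ X = Y + (c₀ * absGaloisRestrict ℚ K ρ) • Y) ∧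
      ∃ ℓ : ℕ, b < ℓ ∧ ℓ.Prime ∧ ¬ ℓ ∣ N ∧ ¬ ((ℓ : ℤ) ∣ NumberField.discr K) ∧ ℓ ≠ 2 ∧
        (Ideal.span {(ℓ : 𝓞 K)}).IsPrime ∧
        (∃ (v : HeightOneSpectrum (𝓞 ℚ)) (𝔓 : Ideal (absIntegers (𝓞 ℚ) ℚ)) (h : absoluteGaloisGroup ℚ),
          (ℓ : 𝓞 ℚ) ∈ v.asIdeal ∧ 𝔓 ∈ v.primesAbove ∧ IsArithFrobAt (𝓞 ℚ) h 𝔓 ∧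
          (∀ P : geomTorsion W ((2 ^ (n + 1) : ℕ) : ℤ), h • P = (c₀ * absGaloisRestrict ℚ K ρ) • P) ∧
          ∀ (e : K →ₐ[ℚ] AlgebraicClosure ℚ) (x : K), h • e x = c₀ • e x) ∧
        2 ^ (n + 1) ∣ ℓ + 1 ∧ ((2 : ℤ) ^ (n + 1)) ∣ W.frobeniusTrace ℓ ∧
        ∀ i, ∀ v : HeightOneSpectrum (𝓞 K), (ℓ : 𝓞 K) ∈ v.asIdeal →
          (((2 : ℤ) ^ Nv i) • cs i ∈
              (W.baseChange K).torsionLocalKer (v.adicCompletion K) ((2 ^ (n + 1) : ℕ) : ℤ) ∧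
            (Nv i ≠ 0 → ((2 : ℤ) ^ (Nv i - 1)) • cs i ∉
              (W.baseChange K).torsionLocalKer (v.adicCompletion K) ((2 ^ (n + 1) : ℕ) : ℤ))) := by
  obtain ⟨hS, hC⟩ := imageTokens_two_of_heegner (W := W) hK hodd hH hρ2
  exact exists_regular_kolyvaginPrime_of_supply hCheb hK n hc₀ (fun A ↦
    exists_mul_absGaloisRestrict_smul_eq_addAut_of_heegner hK hodd hH hsurj c₀ A) hc hS hC cs hπ hcs e he hind hres Nv hNe heM hNπ b

end EnginePortK

end Summit.BirchSwinnertonDyer.BirchSwinnertonDyer.Theorems.OffBigImageOddLocalAtTwo.Engine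

end
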